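import Summits.Langlands.Langlands.Statement
import Summits.Langlands.Langlands.Theorems.BaseFieldAscentReciprocityTRCMWeakGalToAutTROfCM
import Summits.Langlands.Langlands.Theorems.BaseFieldAscentReciprocityTRCMReciprocityCMtoTROfWeak
import Summits.Langlands.Langlands.Theorems.BaseFieldAscentReciprocityTRCMPotentialAutomorphyCMOfItem
import HarnessLib

/-!
# Crux `ReciprocityTRCM` (stmt-Langlands-1093) and support item `ReciprocityCMtoTR` (stmt-Langlands-1096)
# DERIVED from existing ledger items — the end state of line `pieces` (= payload line `registered`)

Support file (closes nothing; `--supports stmt-Langlands-1093`).  After four lead cycles the registered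
skeleton `Cruxes/ReciprocityTRCM/Lines/pieces.lean` closes the crux BY NAME modulo six stubs, every one of
which is an existing ledger item verbatim or a Literature named fact by name.  This file records that end
state as IMPORTABLE sorry-free theorems whose hypotheses are exactly those items / facts, written out
VERBATIM (no route import, no `def`), so that closing the crux — and the shared support item
stmt-Langlands-1096 (routes BaseFieldAscent, CMFern, SmithKummerSeed) — is one `exact` once they land:

* `reciprocityCMtoTR_of_items` — item stmt-Langlands-1096 `ReciprocityCMtoTR` from
  item stmt-Langlands-18032 `ArthurClozelCuspidalDescent` (Arthur–Clozel Ch. 3 Thm. 4.2 (d)), the named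
  fact `ArthurClozel1989_strongLifting_archimedean` (Ch. 3 Thm. 5.1, archimedean clause) and
  item stmt-Langlands-1063 `AutToGalCMtoTR` ((A) CM ⇒ TR, Sorensen patching): weak (B) over totally real
  fields by good CM quadratic base change + cyclic descent + twist matching
  (`weakGalToAutTR_of_reciprocityCM`), upgraded to (B) with local–global compatibility everywhere
  (`reciprocityCMtoTR_of_autToGalCMtoTR_of_weak`).
* `reciprocityTRCM_of_stubs` — the crux statement from the six registered stubs' statements verbatim
  (18032, AC-5.1-arch, 1059 `AutToGalCM`, `stub_potentialAutomorphyCM`, 1062 `DescentOfAutomorphy`, 1063).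
* `reciprocityTRCM_of_items` — the same with the stub `stub_potentialAutomorphyCM` replaced by the item
  that implies it, stmt-Langlands-14091 `PotentialAutomorphy` (`stub_potentialAutomorphyCM_of_potentialAutomorphy`:
  the pinned `pst` makes geometricity datum-independent).

What these hypotheses ARE (for the reader who lands here first): 1059 = direction (A) over CM fields in
all weights (open: the irregular core — Harris–Lan–Taylor–Thorne / Scholze give the regular case);
14091 ⊇ potential automorphy of irreducible geometric `ρ` over CM fields (open off the regular,
residually adequate sector: BLGGT Thm. 4.5.1, ACC+ Thm. 6.1.1); 1062 = descent of weak automorphy along an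
arbitrary finite Galois extension given (A) (open: insoluble descent); 1063 = (A)-transfer CM ⇒ TR (weak
sector landed; full form needs canonical reciprocity data over TR fields, item stmt-Langlands-17930);
18032 and the archimedean clause are theorems in print resting on the twisted trace formula.
Standard axioms; no definitions.

## References
* J. Arthur, L. Clozel, Ann. of Math. Stud. 120 (1989), Ch. 3 Thm. 4.2 (d), Thm. 5.1. [ArthurClozelAMS120]
* P. Deligne, J.-P. Serre, ASENS 7 (1974), Lemme 3.2. [DeligneSerreASENS1974]
* T. Barnet-Lamb, T. Gee, D. Geraghty, R. Taylor, Ann. of Math. 179 (2014), Thm. 4.5.1. [BarnetlambEtAl2014]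
* C. Sorensen, *A patching lemma* (2020), Thm. 1. [Sorensen2020]
-/

noncomputable section

set_option linter.dupNamespace false -- project-wide option (lakefile weak.linter.dupNamespace); `Summit.Langlands.Langlands` is the mandated namespace

open scoped MatrixGroups NumberField
open NumberField IsDedekindDomain Filter
open Literature.NumberTheory.Automorphic Literature.NumberTheory.GaloisRepresentations
open Summit.Langlands

namespace Summit.Langlands.Langlands.Theorems.ReciprocityTRCM

/-- **Item stmt-Langlands-1096 `ReciprocityCMtoTR` from items 18032, 1063 and the archimedean clause of
strong lifting** (all verbatim / by name): reciprocity over all CM fields ⇒ reciprocity over all totally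
real fields. [cite: ArthurClozelAMS120, Ch. 3 Thm. 4.2 (d) and Thm. 5.1] [cite: Sorensen2020, Thm. 1] -/
theorem reciprocityCMtoTR_of_items
    (hdesc : ∀ (n : ℕ) (F E : Type) [Field F] [NumberField F] [Field E] [NumberField E] [Algebra F E] [IsGalois F E] (hF : Literature.NumberTheory.Automorphic.isCompact_glFiniteIntegralLevel n F) (hE : Literature.NumberTheory.Automorphic.isCompact_glFiniteIntegralLevel n E), IsCyclic (E ≃ₐ[F] E) → (Module.finrank F E).Prime → ∀ P : Literature.NumberTheory.Automorphic.CuspidalAutomorphicRepData n E hE, (∀ᶠ w : IsDedekindDomain.HeightOneSpectrum (NumberField.RingOfIntegers E) in Filter.cofinite, ∀ w' : IsDedekindDomain.HeightOneSpectrum (NumberField.RingOfIntegers E), w'.asIdeal.under (NumberField.RingOfIntegers F) = w.asIdeal.under (NumberField.RingOfIntegers F) → ∀ α : Multiset ℂ, P.1.HasSatakeParamAt w α → P.1.HasSatakeParamAt w' α) → ∃ π : Literature.NumberTheory.Automorphic.CuspidalAutomorphicRepData n F hF, ∀ᶠ w : IsDedekindDomain.HeightOneSpectrum (NumberField.RingOfIntegers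 E) in Filter.cofinite, ∀ (v : IsDedekindDomain.HeightOneSpectrum (NumberField.RingOfIntegers F)) (α : Multiset ℂ), w.asIdeal.under (NumberField.RingOfIntegers F) = v.asIdeal → π.1.HasSatakeParamAt v α → P.1.HasSatakeParamAt w (α.map (· ^ w.asIdeal.inertiaDeg (NumberField.RingOfIntegers F))))
    (harch : Literature.NumberTheory.Automorphic.ArthurClozel1989_strongLifting_archimedean)
    (h1063 : (∀ (F : Type) [Field F] [NumberField F], NumberField.IsCMField F → ∃ R : ReciprocityData F, ∀ n : ℕ, 0 < n → ∀ hcpt : Literature.NumberTheory.Automorphic.isCompact_glFiniteIntegralLevel n F, AutomorphicToGalois n R hcpt) → ∀ (F : Type) [Field F] [NumberField F], NumberField.IsTotallyReal F → ∃ R : ReciprocityData F, ∀ n : ℕ, 0 < n → ∀ hcpt : Literature.NumberTheory.Automorphic.isCompact_glFiniteIntegralLevel n F, AutomorphicToGalois n R hcpt) :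
    (∀ (F : Type) [Field F] [NumberField F], NumberField.IsCMField F → ∃ R : ReciprocityData F, ∀ n : ℕ, 0 < n → ∀ hcpt : Literature.NumberTheory.Automorphic.isCompact_glFiniteIntegralLevel n F, GlobalLanglandsCorrespondenceGLn n F R hcpt) → ∀ (F : Type) [Field F] [NumberField F], NumberField.IsTotallyReal F → ∃ R : ReciprocityData F, ∀ n : ℕ, 0 < n → ∀ hcpt : Literature.NumberTheory.Automorphic.isCompact_glFiniteIntegralLevel n F, GlobalLanglandsCorrespondenceGLn n F R hcpt :=
  reciprocityCMtoTR_of_autToGalCMtoTR_of_weak h1063 (weakGalToAutTR_of_reciprocityCM hdesc harch)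

/-- **The crux statement (item stmt-Langlands-1093, verbatim) from the six registered stubs of line
`pieces`, verbatim**: 18032, AC-5.1-arch, 1059 (`X₁`), potential weak automorphy over CM fields and 1062
(together `X₂`), 1063 (with the former stub 5: `X₃`). [cite: DeligneSerreASENS1974, Lemme 3.2]
[cite: ArthurClozelAMS120, Ch. 3 Thm. 4.2 (d) and Thm. 5.1] -/
theorem reciprocityTRCM_of_stubs
    (hdesc : ∀ (n : ℕ) (F E : Type) [Field F] [NumberField F] [Field E] [NumberField E] [Algebra F E] [IsGalois F E] (hF : Literature.NumberTheory.Automorphic.isCompact_glFiniteIntegralLevel n F) (hE : Literature.NumberTheory.Automorphic.isCompact_glFiniteIntegralLevel n E), IsCyclic (E ≃ₐ[F] E) → (Module.finrank F E).Prime → ∀ P : Literature.NumberTheory.Automorphic.CuspidalAutomorphicRepData n E hE, (∀ᶠ w : IsDedekindDomain.HeightOneSpectrum (NumberField.RingOfIntegers E) in Filter.cofinite, ∀ w' : IsDedekindDomain.HeightOneSpectrum (NumberField.RingOfIntegers E), w'.asIdeal.under (NumberField.RingOfIntegers F) = w.asIdeal.under (NumberField.RingOfIntegers F) → ∀ α :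 Multiset ℂ, P.1.HasSatakeParamAt w α → P.1.HasSatakeParamAt w' α) → ∃ π : Literature.NumberTheory.Automorphic.CuspidalAutomorphicRepData n F hF, ∀ᶠ w : IsDedekindDomain.HeightOneSpectrum (NumberField.RingOfIntegers E) in Filter.cofinite, ∀ (v : IsDedekindDomain.HeightOneSpectrum (NumberField.RingOfIntegers F)) (α : Multiset ℂ), w.asIdeal.under (NumberField.RingOfIntegers F) = v.asIdeal → π.1.HasSatakeParamAt v α → P.1.HasSatakeParamAt w (α.map (· ^ w.asIdeal.inertiaDeg (NumberField.RingOfIntegers F))))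
    (harch : Literature.NumberTheory.Automorphic.ArthurClozel1989_strongLifting_archimedean)
    (h1059 : ∀ (F : Type) [Field F] [NumberField F], NumberField.IsCMField F → ∃ R : ReciprocityData F, ∀ n : ℕ, 0 < n → ∀ hcpt : Literature.NumberTheory.Automorphic.isCompact_glFiniteIntegralLevel n F, AutomorphicToGalois n R hcpt)
    (hpot : ∀ (F : Type) [Field F] [NumberField F], NumberField.IsCMField F → ∀ R : ReciprocityData F, (∀ n : ℕ, 0 < n → ∀ hcpt : Literature.NumberTheory.Automorphic.isCompact_glFiniteIntegralLevel n F, AutomorphicToGalois n R hcpt) → ∀ (n : ℕ), 0 < n → ∀ (ℓ : ℕ) [Fact ℓ.Prime] (ι : PadicAlgCl ℓ ≃+* ℂ) (ρ : Literature.NumberTheory.GaloisRepresentations.FramedGaloisRep F (PadicAlgCl ℓ) n), ρ.toGaloisRep.IsIrreducible → IsGeometricFramed R ρ → ∃ (F' : Type) (_ : Field F') (_ : NumberField F') (_ : Algebra F F') (_ : IsGalois F F'), (ρ.restrictField F').toGaloisRep.IsIrreducible ∧ ∃ (hcpt' : Literature.NumberTheory.Automorphic.isCompact_glFiniteIntegralLevel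 n F') (π' : Literature.NumberTheory.Automorphic.CuspidalAutomorphicRepData n F' hcpt'), π'.1.IsLAlgebraic ∧ ∀ᶠ w : IsDedekindDomain.HeightOneSpectrum (NumberField.RingOfIntegers F') in cofinite, SatakeFrobCompatibleAt ι π'.1 (ρ.restrictField F') w)
    (h1062 : ∀ (F : Type) [Field F] [NumberField F] (R : ReciprocityData F), (∀ n : ℕ, 0 < n → ∀ hcpt : Literature.NumberTheory.Automorphic.isCompact_glFiniteIntegralLevel n F, AutomorphicToGalois n R hcpt) → ∀ (n : ℕ), 0 < n → ∀ (ℓ : ℕ) [Fact ℓ.Prime] (ι : PadicAlgCl ℓ ≃+* ℂ) (ρ : Literature.NumberTheory.GaloisRepresentations.FramedGaloisRep F (PadicAlgCl ℓ) n), ρ.toGaloisRep.IsIrreducible → IsGeometricFramed R ρ → (∃ (F' : Type) (_ : Field F') (_ : NumberField F') (_ : Algebra F F') (_ : IsGalois F F'), (ρ.restrictField F').toGaloisRep.IsIrreducible ∧ ∃ (hcpt' : Literature.NumberTheory.Automorphic.isCompact_glFiniteIntegralLevel n F') (π' : Literature.NumberTheory.Automorphic.CuspidalAutomorphicRepData n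 F' hcpt'), π'.1.IsLAlgebraic ∧ ∀ᶠ w : IsDedekindDomain.HeightOneSpectrum (NumberField.RingOfIntegers F') in cofinite, SatakeFrobCompatibleAt ι π'.1 (ρ.restrictField F') w) → ∀ hcpt : Literature.NumberTheory.Automorphic.isCompact_glFiniteIntegralLevel n F, ∃ π : Literature.NumberTheory.Automorphic.CuspidalAutomorphicRepData n F hcpt, π.1.IsLAlgebraic ∧ ∀ᶠ v : IsDedekindDomain.HeightOneSpectrum (NumberField.RingOfIntegers F) in cofinite, SatakeFrobCompatibleAt ι π.1 ρ v)
    (h1063 : (∀ (F : Type) [Field F] [NumberField F], NumberField.IsCMField F → ∃ R : ReciprocityData F, ∀ n : ℕ, 0 < n → ∀ hcpt : Literature.NumberTheory.Automorphic.isCompact_glFiniteIntegralLevel n F, AutomorphicToGalois n R hcpt) → ∀ (F : Type) [Field F] [NumberField F], NumberField.IsTotallyReal F → ∃ R : ReciprocityData F, ∀ n : ℕ, 0 < n → ∀ hcpt : Literature.NumberTheory.Automorphic.isCompact_glFiniteIntegralLevel n F, AutomorphicToGalois n R hcpt) :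
    ∀ (F : Type) [Field F] [NumberField F], (NumberField.IsTotallyReal F ∨ NumberField.IsCMField F) → ∃ R : ReciprocityData F, ∀ n : ℕ, 0 < n → ∀ hcpt : Literature.NumberTheory.Automorphic.isCompact_glFiniteIntegralLevel n F, GlobalLanglandsCorrespondenceGLn n F R hcpt :=
  reciprocityTRCM_of_autToGalCM_of_weakGalToAutCM_of_reciprocityCMtoTR h1059
    (weakGalToAutCM_of_potentialAutomorphyCM_of_descent hpot h1062)
    (reciprocityCMtoTR_of_items hdesc harch h1063)

/-- **The crux statement (item stmt-Langlands-1093, verbatim) from existing ledger items only** — 18032,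
1059, 14091, 1062, 1063 — **and one Literature named fact** (the archimedean clause of Arthur–Clozel's
strong lifting theorem). [cite: DeligneSerreASENS1974, Lemme 3.2] [cite: BarnetlambEtAl2014, Thm. 4.5.1]
[cite: ArthurClozelAMS120, Ch. 3 Thm. 4.2 (d) and Thm. 5.1] -/
theorem reciprocityTRCM_of_items
    (hdesc : ∀ (n : ℕ) (F E : Type) [Field F] [NumberField F] [Field E] [NumberField E] [Algebra F E] [IsGalois F E] (hF : Literature.NumberTheory.Automorphic.isCompact_glFiniteIntegralLevel n F) (hE : Literature.NumberTheory.Automorphic.isCompact_glFiniteIntegralLevel n E), IsCyclic (E ≃ₐ[F] E) → (Module.finrank F E).Prime → ∀ P : Literature.NumberTheory.Automorphic.CuspidalAutomorphicRepData n E hE, (∀ᶠ w : IsDedekindDomain.HeightOneSpectrum (NumberField.RingOfIntegers E) in Filter.cofinite, ∀ w' : IsDedekindDomain.HeightOneSpectrum (NumberField.RingOfIntegers E), w'.asIdeal.under (NumberField.RingOfIntegers F) = w.asIdeal.under (NumberField.RingOfIntegers F) → ∀ α : Multiset ℂ, P.1.HasSatakeParamAt w α → P.1.HasSatakeParamAt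 w' α) → ∃ π : Literature.NumberTheory.Automorphic.CuspidalAutomorphicRepData n F hF, ∀ᶠ w : IsDedekindDomain.HeightOneSpectrum (NumberField.RingOfIntegers E) in Filter.cofinite, ∀ (v : IsDedekindDomain.HeightOneSpectrum (NumberField.RingOfIntegers F)) (α : Multiset ℂ), w.asIdeal.under (NumberField.RingOfIntegers F) = v.asIdeal → π.1.HasSatakeParamAt v α → P.1.HasSatakeParamAt w (α.map (· ^ w.asIdeal.inertiaDeg (NumberField.RingOfIntegers F))))
    (harch : Literature.NumberTheory.Automorphic.ArthurClozel1989_strongLifting_archimedean)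
    (h1059 : ∀ (F : Type) [Field F] [NumberField F], NumberField.IsCMField F → ∃ R : ReciprocityData F, ∀ n : ℕ, 0 < n → ∀ hcpt : Literature.NumberTheory.Automorphic.isCompact_glFiniteIntegralLevel n F, AutomorphicToGalois n R hcpt)
    (h14091 : ∀ (F : Type) [Field F] [NumberField F], (∃ R₀ : ReciprocityData F, ∀ n : ℕ, 0 < n → ∀ hcpt : Literature.NumberTheory.Automorphic.isCompact_glFiniteIntegralLevel n F, AutomorphicToGalois n R₀ hcpt) → ∃ R : ReciprocityData F, (∀ n : ℕ, 0 < n → ∀ hcpt : Literature.NumberTheory.Automorphic.isCompact_glFiniteIntegralLevel n F, AutomorphicToGalois n R hcpt) ∧ ∀ (n : ℕ), 0 < n → ∀ (ℓ : ℕ) [Fact ℓ.Prime] (ι : PadicAlgCl ℓ ≃+* ℂ) (ρ : Literature.NumberTheory.GaloisRepresentations.FramedGaloisRep F (PadicAlgCl ℓ) n), ρ.toGaloisRep.IsIrreducible → IsGeometricFramed R ρ → ∃ (F' : Type) (_ : Field F') (_ : NumberField F') (_ : Algebra F F') (_ : IsGalois F F'), (ρ.restrictField F').toGaloisRep.IsIrreducible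 ∧ ∃ (hcpt' : Literature.NumberTheory.Automorphic.isCompact_glFiniteIntegralLevel n F') (π' : Literature.NumberTheory.Automorphic.CuspidalAutomorphicRepData n F' hcpt'), π'.1.IsLAlgebraic ∧ ∀ᶠ w : IsDedekindDomain.HeightOneSpectrum (NumberField.RingOfIntegers F') in cofinite, SatakeFrobCompatibleAt ι π'.1 (ρ.restrictField F') w)
    (h1062 : ∀ (F : Type) [Field F] [NumberField F] (R : ReciprocityData F), (∀ n : ℕ, 0 < n → ∀ hcpt : Literature.NumberTheory.Automorphic.isCompact_glFiniteIntegralLevel n F, AutomorphicToGalois n R hcpt) → ∀ (n : ℕ), 0 < n → ∀ (ℓ : ℕ) [Fact ℓ.Prime] (ι : PadicAlgCl ℓ ≃+* ℂ) (ρ : Literature.NumberTheory.GaloisRepresentations.FramedGaloisRep F (PadicAlgCl ℓ) n), ρ.toGaloisRep.IsIrreducible → IsGeometricFramed R ρ → (∃ (F' : Type) (_ : Field F') (_ : NumberField F') (_ : Algebra F F') (_ : IsGalois F F'), (ρ.restrictField F').toGaloisRep.IsIrreducible ∧ ∃ (hcpt' : Literature.NumberTheory.Automorphic.isCompact_glFiniteIntegralLevel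 n F') (π' : Literature.NumberTheory.Automorphic.CuspidalAutomorphicRepData n F' hcpt'), π'.1.IsLAlgebraic ∧ ∀ᶠ w : IsDedekindDomain.HeightOneSpectrum (NumberField.RingOfIntegers F') in cofinite, SatakeFrobCompatibleAt ι π'.1 (ρ.restrictField F') w) → ∀ hcpt : Literature.NumberTheory.Automorphic.isCompact_glFiniteIntegralLevel n F, ∃ π : Literature.NumberTheory.Automorphic.CuspidalAutomorphicRepData n F hcpt, π.1.IsLAlgebraic ∧ ∀ᶠ v : IsDedekindDomain.HeightOneSpectrum (NumberField.RingOfIntegers F) in cofinite, SatakeFrobCompatibleAt ι π.1 ρ v)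
    (h1063 : (∀ (F : Type) [Field F] [NumberField F], NumberField.IsCMField F → ∃ R : ReciprocityData F, ∀ n : ℕ, 0 < n → ∀ hcpt : Literature.NumberTheory.Automorphic.isCompact_glFiniteIntegralLevel n F, AutomorphicToGalois n R hcpt) → ∀ (F : Type) [Field F] [NumberField F], NumberField.IsTotallyReal F → ∃ R : ReciprocityData F, ∀ n : ℕ, 0 < n → ∀ hcpt : Literature.NumberTheory.Automorphic.isCompact_glFiniteIntegralLevel n F, AutomorphicToGalois n R hcpt) :
    ∀ (F : Type) [Field F] [NumberField F], (NumberField.IsTotallyReal F ∨ NumberField.IsCMField F) → ∃ R : ReciprocityData F, ∀ n : ℕ, 0 < n → ∀ hcpt : Literature.NumberTheory.Automorphic.isCompact_glFiniteIntegralLevel n F, GlobalLanglandsCorrespondenceGLn n F R hcpt :=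
  reciprocityTRCM_of_stubs hdesc harch h1059 (stub_potentialAutomorphyCM_of_potentialAutomorphy h14091)
    h1062 h1063

end Summit.Langlands.Langlands.Theorems.ReciprocityTRCM

end
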